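import Summits.AtomisticToContinuum.BoseEinsteinCondensation.Theses.BECStronglyRayleigh
import Summits.AtomisticToContinuum.BoseEinsteinCondensation.Theorems.InsertionFieldDelocalisation.Negative.Toolkit
import Summits.AtomisticToContinuum.BoseEinsteinCondensation.Theorems.InsertionFieldDelocalisation.Negative.Tightness
import Summits.AtomisticToContinuum.BoseEinsteinCondensation.Theorems.InsertionFieldDelocalisation.Negative.PerronExistence
import Summits.AtomisticToContinuum.BoseEinsteinCondensation.Theorems.BECStronglyRayleighInsertionFieldDelocalisationEmbedding
import Literature.MathematicalPhysics.QuantumLattice.FinDimSpectrumSectorGibbsLimit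
import HarnessLib

/-!
# Negative-lane toolkit for crux `InsertionFieldDelocalisation` (stmt-AtomisticToContinuum-9673), VIII:
# degrees of the torus graph and the pair energy `E(2) ≤ -5`

Supports (does not close) stmt-AtomisticToContinuum-9673; nothing here asserts a Theses statement or a
stub (drefute seat; inputs of `CoshBudgetLoadBearing.lean` and small facts the provers of line
`cosh-budget-penrose-onsager` need for the kinetic normalisation `Σ_dir ΦΦ' ≍ 6(N+1)‖Φ‖²`).

* `torus_neighbors_subset`, `torus_degree_le_six` — every neighbour of `x` in `(ℤ/Lℤ)³` is `x ± eᵢ`,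
  so the degree is at most six (any `L`);
* `torus_degree_eq_six` — for `L ≥ 3` the six are distinct (`1 ≠ 0` and `1 + 1 ≠ 0` in `ℤ/Lℤ`):
  the torus graph is 6-regular; `five_le_hops` — from a vertex of a two-set at least five hops leave it;
* `lowestEnergy_two_le_neg_five` — **`E(2) ≤ -5` for `L ≥ 3`**: the flat vector on two-sets lies in
  the sector `S³_tot = 2 - L³/2`, and by the row formula (`mt3em_xxzZero_mulVec_ind`, landed with
  `stub_embedding`) its Rayleigh quotient is `-½·(mean number of hops out of a two-set) ≤ -5`
  (`ten_le_hops_pair`); variational principle `minEnergyOn_le_rayleigh_of_mem`.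
-/

noncomputable section

namespace Summit.AtomisticToContinuum.BoseEinsteinCondensation.Theorems.InsertionFieldDelocalisation.Negative

open scoped BigOperators ComplexOrder
open Literature.MathematicalPhysics.QuantumLattice Literature.Probability.LatticeModels Matrix Finset
open Summit.AtomisticToContinuum.BoseEinsteinCondensation.Theses.BECStronglyRayleigh

/-! ### Degrees of the torus graph `(ℤ/Lℤ)³` -/

variable {L : ℕ}

/-- Every neighbour of `x` is `x ± eᵢ`. [folklore] -/
theorem torus_neighbors_subset [NeZero L] (x : TorusSite 3 L) :
    (Finset.univ.filter fun y => (torusGraph 3 L).Adj x y) ⊆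
      (Finset.univ : Finset (Fin 3 × Bool)).image
        (fun p => x + (if p.2 then Pi.single p.1 1 else -Pi.single p.1 1)) := by
  intro y hy
  rw [Finset.mem_filter] at hy
  obtain ⟨-, ⟨i, hi⟩ | ⟨i, hi⟩⟩ := (torusGraph_adj_iff x y).mp hy.2
  · exact Finset.mem_image.mpr ⟨(i, true), Finset.mem_univ _, by simp [hi]⟩
  · refine Finset.mem_image.mpr ⟨(i, false), Finset.mem_univ _, ?_⟩
    rw [hi]
    simp

/-- **Degree at most six** on `(ℤ/Lℤ)³`. [folklore] -/
theorem torus_degree_le_six [NeZero L] (x : TorusSite 3 L) :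
    (Finset.univ.filter fun y => (torusGraph 3 L).Adj x y).card ≤ 6 := by
  refine (Finset.card_le_card (torus_neighbors_subset x)).trans ?_
  refine Finset.card_image_le.trans ?_
  simp

/-- **Six distinct neighbours** for `L ≥ 3`: `x ± eᵢ`. [folklore] -/
theorem torus_degree_eq_six [NeZero L] (hL : 3 ≤ L) (x : TorusSite 3 L) :
    (Finset.univ.filter fun y => (torusGraph 3 L).Adj x y).card = 6 := by
  haveI : Fact (1 < L) := ⟨by omega⟩
  have h1 : (1 : ZMod L) ≠ 0 := one_ne_zero
  have hm1 : (-1 : ZMod L) ≠ 0 := neg_ne_zero.mpr h1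
  have h11 : (1 : ZMod L) + 1 ≠ 0 := by
    -- `2 ≠ 0` in `ℤ/L` for `L ≥ 3` (cf. `zmod_one_add_one_ne_zero_of_three_le` in the Hubbard torus file)
    intro h
    have h2 : ((2 : ℕ) : ZMod L) = 0 := by push_cast; rw [← h]; ring
    have := congrArg ZMod.val h2
    rw [ZMod.val_natCast, Nat.mod_eq_of_lt (by omega), ZMod.val_zero] at this
    omega
  have h2 : (1 : ZMod L) ≠ -1 := by
    intro h
    exact h11 (by linear_combination h)
  set g : Fin 3 × Bool → TorusSite 3 L :=
    fun p => if p.2 then Pi.single p.1 1 else -Pi.single p.1 1 with hg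
  have hgi : ∀ (i : Fin 3) (b : Bool), g (i, b) i = if b then 1 else -1 := by
    intro i b; cases b <;> simp [hg]
  have hgj : ∀ (i j : Fin 3) (b : Bool), i ≠ j → g (i, b) j = 0 := by
    intro i j b hij; cases b <;> simp [hg, Pi.single_eq_of_ne (Ne.symm hij)]
  have hg0 : ∀ p, g p ≠ 0 := by
    rintro ⟨i, b⟩ h
    have := congrFun h i
    rw [hgi] at this
    cases b
    · simp only [Bool.false_eq_true, if_false, Pi.zero_apply] at this
      exact hm1 this
    · simp only [if_true, Pi.zero_apply] at this
      exact h1 this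
  -- `p ↦ x + g p` is injective
  have hinj : Function.Injective (fun p => x + g p) := by
    rintro ⟨i, b⟩ ⟨j, c⟩ hpq
    have key : g (i, b) = g (j, c) := add_left_cancel hpq
    by_cases hij : i = j
    · subst hij
      have := congrFun key i
      rw [hgi, hgi] at this
      cases b <;> cases c
      · rfl
      · exact absurd this.symm h2
      · exact absurd this h2
      · rfl
    · exfalso
      have := congrFun key i
      rw [hgi, hgj j i c (Ne.symm hij)] at this
      cases b
      · simp only [Bool.false_eq_true, if_false] at this
        exact hm1 this
      · simp only [if_true] at this
        exact h1 this
  -- every image point is a neighbour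
  have hsub : (Finset.univ : Finset (Fin 3 × Bool)).image (fun p => x + g p) ⊆
      Finset.univ.filter fun y => (torusGraph 3 L).Adj x y := by
    intro y hy
    obtain ⟨⟨i, b⟩, -, rfl⟩ := Finset.mem_image.mp hy
    rw [Finset.mem_filter]
    refine ⟨Finset.mem_univ _, ?_⟩
    rw [torusGraph_adj_iff]
    refine ⟨fun h => hg0 (i, b) (left_eq_add.mp h), ?_⟩
    cases b
    · right
      exact ⟨i, by simp [hg]⟩
    · left
      exact ⟨i, by simp [hg]⟩
  apply le_antisymm (torus_degree_le_six x)
  calc 6 = ((Finset.univ : Finset (Fin 3 × Bool)).image (fun p => x + g p)).card := by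
        rw [Finset.card_image_of_injective _ hinj]; simp
    _ ≤ _ := Finset.card_le_card hsub

/-- From a vertex of a two-set at least five hops leave the set (`L ≥ 3`). [folklore] -/
theorem five_le_hops [NeZero L] (hL : 3 ≤ L) {a c : TorusSite 3 L} (hac : a ≠ c) :
    5 ≤ (Finset.univ.filter fun b => b ∉ ({a, c} : Finset (TorusSite 3 L)) ∧
      (torusGraph 3 L).Adj a b).card := by
  have hsub : (Finset.univ.filter fun y => (torusGraph 3 L).Adj a y) \ {c} ⊆
      Finset.univ.filter fun b => b ∉ ({a, c} : Finset (TorusSite 3 L)) ∧ (torusGraph 3 L).Adj a b := by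
    intro b hb
    rw [Finset.mem_sdiff, Finset.mem_filter, Finset.mem_singleton] at hb
    rw [Finset.mem_filter, Finset.mem_insert, Finset.mem_singleton]
    refine ⟨Finset.mem_univ _, ?_, hb.1.2⟩
    rintro (rfl | rfl)
    · exact hb.1.2.ne rfl
    · exact hb.2 rfl
  have h6 := torus_degree_eq_six hL a
  have hcard := Finset.card_le_card hsub
  have hsd : (Finset.univ.filter fun y => (torusGraph 3 L).Adj a y).card ≤
      ((Finset.univ.filter fun y => (torusGraph 3 L).Adj a y) \ {c}).card + ({c} : Finset _).card :=
    Finset.card_le_card_sdiff_add_card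
  rw [Finset.card_singleton, h6] at hsd
  omega

/-! ### The pair energy: `E(2) ≤ -5` on `(ℤ/Lℤ)³`, `L ≥ 3` (flat pair trial vector) -/

/-- The occupied set of an indicator configuration is the set. [folklore] -/
theorem filter_ind_eq_zero [NeZero L] (S : Finset (TorusSite 3 L)) :
    (Finset.univ.filter fun z => (if z ∈ S then (0 : Fin 2) else 1) = 0) = S := by
  ext z
  simp

/-- The number of hops out of a two-set is at least ten (`L ≥ 3`). [folklore] -/
theorem ten_le_hops_pair [NeZero L] (hL : 3 ≤ L) {S : Finset (TorusSite 3 L)} (hS : S.card = 2) :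
    (10 : ℝ) ≤ ∑ a ∈ S, ∑ b : TorusSite 3 L,
      (if b ∉ S ∧ (torusGraph 3 L).Adj a b then (1 : ℝ) else 0) := by
  obtain ⟨a, c, hac, rfl⟩ := Finset.card_eq_two.mp hS
  rw [Finset.sum_pair hac]
  have ha := five_le_hops hL hac
  have hc := five_le_hops hL (Ne.symm hac)
  rw [Finset.pair_comm c a] at hc
  rw [Finset.sum_boole, Finset.sum_boole]
  have ha' : (5 : ℝ) ≤ ((Finset.univ.filter fun b => b ∉ ({a, c} : Finset (TorusSite 3 L)) ∧
      (torusGraph 3 L).Adj a b).card : ℝ) := by exact_mod_cast ha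
  have hc' : (5 : ℝ) ≤ ((Finset.univ.filter fun b => b ∉ ({a, c} : Finset (TorusSite 3 L)) ∧
      (torusGraph 3 L).Adj c b).card : ℝ) := by exact_mod_cast hc
  linarith

/-- **`E(2) ≤ -5` for `L ≥ 3`**: the flat vector on two-sets has Rayleigh quotient
`-½ · (mean number of hops) ≤ -5`, since each of the two particles keeps at least five of its six moves
(`torus_degree_eq_six`); variational principle `minEnergyOn_le_rayleigh_of_mem`. [folklore] -/
theorem lowestEnergy_two_le_neg_five [NeZero L] (hL : 3 ≤ L) :
    lowestEnergyInSector 1 (xyTorus 3 L 1) (((2 : ℕ) : ℝ) - (L : ℝ) ^ 3 / 2) ≤ -5 := by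
  -- the flat pair vector and its support predicate
  set φ : TensorIndex (TorusSite 3 L) 2 → ℂ :=
    fun σ => if (Finset.univ.filter fun z => σ z = 0).card = 2 then 1 else 0 with hφ
  have hφP : ∀ σ, (Finset.univ.filter fun z => σ z = 0).card = 2 → φ σ = 1 := fun σ h => by
    simp [hφ, h]
  have hφN : ∀ σ, (Finset.univ.filter fun z => σ z = 0).card ≠ 2 → φ σ = 0 := fun σ h => by
    simp [hφ, h]
  have hφind : ∀ T : Finset (TorusSite 3 L), T.card = 2 →
      φ (fun z => if z ∈ T then 0 else 1) = 1 := by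
    intro T hT
    apply hφP
    rw [filter_ind_eq_zero, hT]
  -- sector membership
  have hsec : φ ∈ spinZSector 1 (((2 : ℕ) : ℝ) - (L : ℝ) ^ 3 / 2) := by
    rw [LiebMattis.mem_spinZSector_iff]
    intro σ hσ
    have hP : (Finset.univ.filter fun z => σ z = 0).card = 2 := by
      by_contra h; exact hσ (hφN σ h)
    have hσeq := ind_filter_eq σ
    have key : (∑ x, ((((1 : ℕ) : ℂ)) / 2 - ((σ x : ℕ) : ℂ))) =
        ∑ x, ((((1 : ℕ) : ℂ)) / 2 - (((if x ∈ Finset.univ.filter (fun z => σ z = 0) then (0 : Fin 2)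
          else 1 : Fin 2) : ℕ) : ℂ)) :=
      Finset.sum_congr rfl fun x _ => by rw [← congrFun hσeq x]
    rw [key, magnetisation_ind, hP, card_torusSite 3 L]
    push_cast
    ring
  -- the row formula on the support: `Re (Hφ)(1_S) ≤ -5`
  have hrow : ∀ σ, (Finset.univ.filter fun z => σ z = 0).card = 2 →
      ((xyTorus 3 L 1 *ᵥ φ) σ).re ≤ -5 := by
    intro σ hP
    set S := Finset.univ.filter fun z => σ z = 0 with hS
    have hσeq : (fun z => if z ∈ S then (0 : Fin 2) else 1) = σ := ind_filter_eq σ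
    rw [← hσeq]
    rw [show xyTorus 3 L 1 = xxzHamiltonian 1 (torusGraph 3 L) (-1) 0 from rfl,
      Cruxes.InsertionFieldDelocalisation.MobileTrapDirichletEigenfunction.mt3em_xxzZero_mulVec_ind]
    -- every target configuration is again a two-set, so `φ = 1` there
    have hterm : ∀ a ∈ S, ∀ b : TorusSite 3 L,
        (if b ∉ S ∧ (torusGraph 3 L).Adj a b then
          φ (fun z => if z ∈ insert b (S.erase a) then 0 else 1) else 0) =
        ((if b ∉ S ∧ (torusGraph 3 L).Adj a b then (1 : ℝ) else 0 : ℝ) : ℂ) := by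
      intro a ha b
      by_cases h : b ∉ S ∧ (torusGraph 3 L).Adj a b
      · rw [if_pos h, if_pos h, hφind]
        · simp
        · rw [Finset.card_insert_of_notMem (fun hb => h.1 (Finset.mem_of_mem_erase hb)),
            Finset.card_erase_of_mem ha, hP]
      · rw [if_neg h, if_neg h]; simp
    rw [Finset.sum_congr rfl fun a ha => Finset.sum_congr rfl fun b _ => hterm a ha b]
    have hcast : (∑ a ∈ S, ∑ b : TorusSite 3 L,
        (((if b ∉ S ∧ (torusGraph 3 L).Adj a b then (1 : ℝ) else 0 : ℝ)) : ℂ)) =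
        ((∑ a ∈ S, ∑ b : TorusSite 3 L,
          (if b ∉ S ∧ (torusGraph 3 L).Adj a b then (1 : ℝ) else 0) : ℝ) : ℂ) := by
      rw [Complex.ofReal_sum]
      exact Finset.sum_congr rfl fun a _ => (Complex.ofReal_sum _ _).symm
    rw [hcast, ← Complex.ofReal_mul, Complex.ofReal_re]
    have h10 := ten_le_hops_pair hL hP
    linarith
  -- the two dot products of `φ`
  set n : ℕ := (Finset.univ.filter fun σ : TensorIndex (TorusSite 3 L) 2 =>
      (Finset.univ.filter fun z => σ z = 0).card = 2).card with hn
  have hnorm : star φ ⬝ᵥ φ = (n : ℂ) := by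
    rw [dotProduct]
    have hterm : ∀ σ : TensorIndex (TorusSite 3 L) 2, star φ σ * φ σ =
        if (Finset.univ.filter fun z => σ z = 0).card = 2 then (1 : ℂ) else 0 := by
      intro σ
      rw [Pi.star_apply]
      by_cases h : (Finset.univ.filter fun z => σ z = 0).card = 2
      · rw [hφP σ h, if_pos h]; simp
      · rw [hφN σ h, if_neg h]; simp
    rw [Finset.sum_congr rfl fun σ _ => hterm σ, Finset.sum_boole, hn]
  have hquad : (star φ ⬝ᵥ (xyTorus 3 L 1 *ᵥ φ)).re ≤ -5 * n := by
    rw [dotProduct, Complex.re_sum]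
    have hterm : ∀ σ : TensorIndex (TorusSite 3 L) 2, (star φ σ * (xyTorus 3 L 1 *ᵥ φ) σ).re ≤
        if (Finset.univ.filter fun z => σ z = 0).card = 2 then (-5 : ℝ) else 0 := by
      intro σ
      rw [Pi.star_apply]
      by_cases h : (Finset.univ.filter fun z => σ z = 0).card = 2
      · rw [hφP σ h, if_pos h, star_one, one_mul]
        exact hrow σ h
      · rw [hφN σ h, if_neg h, star_zero, zero_mul, Complex.zero_re]
    calc ∑ σ, (star φ σ * (xyTorus 3 L 1 *ᵥ φ) σ).re
        ≤ ∑ σ : TensorIndex (TorusSite 3 L) 2,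
            (if (Finset.univ.filter fun z => σ z = 0).card = 2 then (-5 : ℝ) else 0) :=
          Finset.sum_le_sum fun σ _ => hterm σ
      _ = -5 * n := by
          rw [Finset.sum_ite, Finset.sum_const_zero, add_zero, Finset.sum_const, nsmul_eq_mul, hn]
          ring
  have hnpos : 0 < n := by
    obtain ⟨a, b, hab⟩ := exists_pair_torusSite L (by omega)
    rw [hn, Finset.card_pos]
    refine ⟨fun z => if z ∈ ({a, b} : Finset (TorusSite 3 L)) then 0 else 1, ?_⟩
    rw [Finset.mem_filter]
    refine ⟨Finset.mem_univ _, ?_⟩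
    rw [filter_ind_eq_zero, Finset.card_pair hab]
  have hnR : (0 : ℝ) < n := by exact_mod_cast hnpos
  -- normalise and apply the variational principle
  set c : ℝ := 1 / Real.sqrt n with hc
  have hc2 : c * c * (n : ℝ) = 1 := by
    rw [hc, div_mul_div_comm, one_mul, Real.mul_self_sqrt hnR.le, one_div, inv_mul_cancel₀ hnR.ne']
  set ψ : TensorIndex (TorusSite 3 L) 2 → ℂ := (c : ℂ) • φ with hψ
  have hψmem : ψ ∈ spinZSector 1 (((2 : ℕ) : ℝ) - (L : ℝ) ^ 3 / 2) := Submodule.smul_mem _ _ hsec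
  have hstar : star ψ = (c : ℂ) • star φ := by
    rw [hψ, star_smul, Complex.star_def, Complex.conj_ofReal]
  have h1 : star ψ ⬝ᵥ ψ = 1 := by
    rw [hstar, hψ, smul_dotProduct, dotProduct_smul, hnorm, smul_eq_mul, smul_eq_mul, ← mul_assoc]
    have : ((c * c * n : ℝ) : ℂ) = 1 := by rw [hc2]; simp
    push_cast at this
    exact this
  have hray : (star ψ ⬝ᵥ (xyTorus 3 L 1 *ᵥ ψ)).re ≤ -5 := by
    rw [hstar, hψ, Matrix.mulVec_smul, smul_dotProduct, dotProduct_smul, smul_eq_mul, smul_eq_mul,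
      ← mul_assoc, show ((c : ℂ) * (c : ℂ)) = ((c * c : ℝ) : ℂ) by push_cast; ring,
      Complex.re_ofReal_mul]
    have hcc : 0 ≤ c * c := mul_self_nonneg c
    calc c * c * (star φ ⬝ᵥ (xyTorus 3 L 1 *ᵥ φ)).re ≤ c * c * (-5 * n) :=
          mul_le_mul_of_nonneg_left hquad hcc
      _ = -5 * (c * c * n) := by ring
      _ = -5 := by rw [hc2]; ring
  have hH : (xyTorus 3 L 1).IsHermitian := xxzZero_isHermitian (torusGraph 3 L) (-1)
  have hle := minEnergyOn_le_rayleigh_of_mem hH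
    (spinZSector 1 (((2 : ℕ) : ℝ) - (L : ℝ) ^ 3 / 2)) hψmem h1
  unfold lowestEnergyInSector
  exact hle.trans hray


end Summit.AtomisticToContinuum.BoseEinsteinCondensation.Theorems.InsertionFieldDelocalisation.Negative

end
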